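import Literature.MathematicalPhysics.QuantumFieldTheory.Balaban1983to89.B6Grad2NormSuppLegKLevelV1
import Literature.MathematicalPhysics.QuantumFieldTheory.Balaban1983to89.B6CubeCoeffSizesV1

/-!
# `Balaban1983to89.B6LineOneENormSuppKLevelV1` — T. Bałaban, *Propagators and renormalization transformations for lattice gauge theories. II*,
# Commun. Math. Phys. **96** (1984) 223–250 [Balaban1984PropagatorsII], (2.92) line 1 × (2.141) p. 239/247: THE FIRST-ORDER LETTERS
# `c_e·E_e·(G_□·h_□·∇*_ν)` OF THE LAST LEGS `K_{□,□}G_□h_□∇*_ν` ON THE CENSUS HÖLDER CLASS OF (2.138), PER CUBE AND PER `e = (λ, ±)` — module (L2b) of the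
# N03 slot-c3 programme of cell pub-ymgap (seats dag-n03-b ∕ dag-p1 = n03-a; cell bus 2026-08-25T22:04Z–22:22Z)

statement-level skeleton of published theorems with citation tags; proofs where landed; nothing here is a claim about the Yang–Mills mass gap

PRINT (p. 239 [PDF 17], `paper:balaban1984-cmp96-propagators-rt-ii`, journal page = PDF page + 222): *"K_{□,□} = … Σ_{b∈st(x)}(∂h_□)(b)(∂A_μ)(b) + (Δh_□)(x)A_μ(x) …
(2.92)"*; p. 247 [PDF 25]: *"Similarly the estimates (2.94) hold, and together with (2.133) they give |(K_{□,□′}G_{□′}h_{□′}J)(x)| ≤ O(M⁻¹)e^{−½δ₂d(y,y′)}|J| (2.134)"*,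
*"|(∇G∇*J)(x)| ≤ O(1)e^{−δ₃d(y,y′)}(‖J‖^{ξ′}_ε + |J|) (2.138)"*, *"G = G₀(I − R)⁻¹ = Σ G₀Rⁿ … (2.141) and the series above is convergent in the norms appearing
in the inequalities (2.136)–(2.140)"*; [Balaban1984PropagatorsI] Prop. 1.2 (1.112) p. 36 (the member estimate for `∇G∇*`).

CITATION HEADER (lean-in-tree rule) — WHAT IS REPRODUCED.  Cell pub-ymgap, seat `pub-ymgap-dag-p1` = n03-a (Track-A node N03; HUMAN RULING D-0062, chair R429),
module **(L2b)** of seat dag-n03-b's decomposition of the census slot c3 = (2.138) at k levels (`B6Ineq2138KLevelSkeletonV1`: c3 ⇐ the last legs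
`K_{□,□′}G_{□′}h_{□′}∇*_ν` on the Hölder class; (L1) `B6Ineq2134RightFactorA` glues them from per-letter inputs; THIS FILE is the line-1 `E`-letter input, ONE
theorem with the signature dag-n03-b displayed on the cell bus 2026-08-25T22:12Z).  In (2.141) read for the entry `∇G∇*` the diagonal kernel `K_{□,□}` of (2.92)
carries the first-order term `Σ_e c_e·E_e` (p38's `cfC`∕`EC` of `B6Eq292MemberTorusV1.hdec_cube`); acting on `G_□h_□∇*_νJ` it puts TWO differences on the
member `G_□`, so the input `J` is measured in the Hölder class `‖J‖_ε + |J|` — the member (1.112), at k levels p27's `B6CubeNormSuppInDecayV1.hEGE_cube`.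
* §1 generic letters: `hasMajorantA_mulOp_left_le` (a left multiplier of size `≤ s`); the bond identities `mulOp_mul_DVa` (`h·∇*_ν = ∇*_ν·(S_νh) + (∇_νh)·`,
  the transpose of p38's `DV_mul_mulOp`), `DVa_eq_neg_shBi_mul_DV` (`∇*_ν = −S_ν⁻¹∇_ν`), `mulOp_mul_shBi` (`χ·S_ν⁻¹ = S_ν⁻¹·(S_νχ)·`).
* §2 the cube: `cfC_deep2` ∕ `shB_cfC_deep1` (the coefficients `c_e` are `2`-deep in the member's window — differences of `h^ch_□`, margin `4L^{j₀+1}`, r03's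
  `hch_deep` + p38's `extend_smul_Dl/Dla_apply`), **`DVa_mul_mulOp_shB_hB`** (`∇*_ν·(S_νh_□) = (c′/L^{j₀})•E_(ν,−)·(S_νh_□)`, the transpose of p38's
  `mulOp_mul_EC_true` through `B6OpTransposeV1.tr`, `tr_EC`, `tr_DV`), **`mulOp_cfC_mul_EC_false`** (`c_e·E_(λ,−) = S_λ⁻¹·(−S_λc_e)·E_(λ,+)`: the backward
  letter is the forward one behind a unit shift; p38's `mulOp_mul_EC_false`∕`_true`), **`hasMajorantA_shBi_mul`** (a unit backward shift of the output costs
  `e^{ρ}`: dag-p1 g0's `B6Ineq2142KLevelV1.distT_shift_le_one` + the triangle inequality of `bondT D`).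
* §3 **`lineOneE_hB_DVa_normSupp`** — ∃ ρ > 0 (on `d, L, a₀, a₁`), ∀ ε ∈ (0,1), ∃ C_ε ≥ 0: on every admissible V1 torus (`M_h = Lᵃ ≥ 8`, `R ≥ 2L²`, `P′ ≥ 5`,
  `L ≥ 5`, cube placed), every `c′ ≠ 0`, `w`, `ν`, `e`:
  `HasMajorantA (geomT D) (blkV1 hN D) (NormSupp blkV1 {y′} (‖·‖_ε + |·|)) (c_e·E_e·(G_□·(h_□·∇*_ν))) (C_ε/(L·M_h)·e^{−ρd_T(y,y′)}·(|c′|/L^{j(y′)}))` —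
  print's `O(M⁻¹)` of (2.134) with the input length `(L^{j′}η)⁻¹` at the INPUT block.  Route (dag-n03-b's): `h_□∇*_ν = ∇*_ν(S_νh_□) + (∇_νh_□)`, so the
  letter is `(c′/L^{j₀})•c_e·(E_eG_□E_(ν,−))·(S_νh_□) + c_e·(E_eG_□)·(∇_νh_□)`; the first summand = `hEGE_cube` (behind a unit shift for `e = (λ,−)`) with the
  right cut-off `S_νh_□` (p27 `hasMajorantA_mul_right_ind` + `normSupp_mulOp` + `lip_shB_hB`, pattern (a) of `hD2hGh0_cube`) and the coefficient
  `|c_e| ≤ s(□)L^{j₀}C1F/(8S/5)` (p38 `abs_cfC_chart_le`; `s(□)` cancels `hEGE`'s `s(□)⁻¹`); the second = the sup leg `hEGin_cube` sandwiched between `c_e` and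
  `|∇_νh_□| ≤ |c′|C1F/(8S/5)` (`hasMajorant_sandwich_in_both`), read on the Hölder class (`hasMajorantA_normSupp_of_sup`); finally `M_h·L^{j(y′)} ≤ S = M_hL^{j+1}`
  on the reach (`level_le_of_mem_QT`) turns `1/S` into print's `M⁻¹·(L^{j′}η)⁻¹`.
THEOREMS ONLY (no `def`, no `def … : Prop`, no new hypothesis-shaped fact); IMPORTS BY NAME (`B6Grad2NormSuppLegKLevelV1`, `B6CubeCoeffSizesV1`); standard axioms.

HONEST SCOPE ∕ DIVERGENCES.  (1) `L ≥ 5`, `M_h = Lᵃ ≥ 8`, `R ≥ 2L²`, `P′ ≥ 5`, cube placed — the V1 setting of the imported files; constants on `d, L, a₀, a₁, ε`,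
the rate on `d, L, a₀, a₁` — NOT on `k, M_h, c′` (uniformity).  (2) The census sub-case `supp J ⊂ Δ(y′)` (one block) of print's `Δ̃(y′)` (cell GAPS
G-B6-2138-SUPP); the kernel carries NO input indicator (inputs off the reach are killed by `h_□∇*_ν`, dag-n03-b's `inKill_hB_DVa`, in the assembly).
(3) `set_option maxHeartbeats 1000000` on the one assembly theorem (length of the bookkeeping, not search).  (4) The zeroth-order letter `c₀·G_□h_□∇*_ν`, the
`Q*aQ` commutators, lines 2–4 of (2.92) and the off-diagonal (2.93) on the Hölder class are NOT here (dag-n03-b's (L1)∕(L2a)∕(L3)).  Integer torus, lattice units;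
nothing on d = 4 specifically or the continuum; a T1 slot input, NOT a node discharge; NOT summit progress.  Seat `pub-ymgap-dag-p1` (g2), 2026-08-25.
-/

noncomputable section

open scoped BigOperators
open Finset

namespace Literature.MathematicalPhysics.QuantumFieldTheory.Balaban1983to89.B6LineOneENormSuppKLevelV1

open LatticeFieldCalculus (supDist)
open B6MultiLevelBoxOperator (N0 bigSide)
open B6MultiLevelTorusOperator (TDomains)
open B6Cover236MultiLevelBlocks (cubes)
open B6Geom246MultiLevelBox (bset blkOf)
open B6Geom246MultiLevelTorus (geomT bondT connectedT)
open B8Ineq192MultiLevelTorus (geomT_len lenT_eq lenT_pos)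
open B6RandomWalk (HasMajorant BlockSupp)
open B6Prop26Gluing (mulOp mulOp_apply ind ind_nonneg ind_le_one ind_of_mem ind_of_not_mem)
open B6GlobalChartV1 (PV toBox blkV1 domT)
open B6SectAOperatorsV1 (BondIdx)
open B6Ineq2133TwoScaleV1 (onFun)
open B6Partition118KLevelFineSizes (C1F C1F_nonneg)
open B6Partition118KLevelTorusCentral (one_le_of_four_le)
open B6Prop26KLevelSkeletonV1 (hB ST mem_ST pref pref_nonneg abs_hB_le_one)
open B6InMajorantTransplant (InMajorant)
open B6AgreeLapV1Chart (cB eB DeepS mem_cB_W deepS_mono shift_mem_deepS unshift_mem_deepS)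
open B6Prop26ReachTransplant (restrictOp extendOp extendOp_apply)
open B6TranslateV1 (trV trV_apply trV_trV_neg)
open B6TranslateTorusV1 (vch)
open B6Eq238MultiLevelTorus (svec)
open B6CubeWindowV1 (tC tC_j sc sc_ne_zero x0 hx0 hfit wC hch hch_deep Placed j0 j0_le_level Gl)
open B6CubeInDecayV1 (hEGin_cube sc_nonneg)
open B6Eq292MemberTorusV1 (EC cfC)
open B6CubeCoeffSizesV1 (cfC_supp abs_cfC_chart_le level_le_of_mem_QT hch_deep1 extend_smul_Dl_apply extend_smul_Dla_apply extend_apply_of_not_mem)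
open B6GradLegKLevelV1 (shB shB_apply DV DV_apply DV_mul_mulOp mulOp_mul_EC_true shB_hB_deep trV_shB pref_scale_le)
open B6LapLegKLevelV1 (shBi shBi_apply DVa DVa_apply mulOp_mul_EC_false trV_shBi)
open B6OpTransposeV1 (tr tr_mul tr_add tr_smul tr_mulOp tr_EC)
open B6GDVaLegKLevelV1 (tr_DV)
open B6Ineq2142KLevelV1 (distT_shift_le_one)
open B6RandomWalkInputNorm (HasMajorantA NormSupp hasMajorantA_smul hasMajorantA_mono hasMajorantA_add hasMajorantA_neg)
open B6RandomWalkInputNormChain (mulOp_eq_zero_of_region)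
open B6HolderNormV1 (supNormV1 holderV1 abs_le_supNormV1 holderV1_nonneg normSupp_mulOp)
open B6NormSuppDecayWindowV1 (hasMajorantA_mul_right_ind)
open B6CubeNormSuppInDecayV1 (hEGE_cube)
open B6Grad2LegLettersKLevelV1 (hasMajorant_sandwich_in_both hasMajorantA_normSupp_of_sup lip_shB_hB len_lip_le supp_shB_hB supp_DV_hB abs_DV_hB_le)
open B10StarCount (shift_unshift unshift_shift)

variable {d ℓ : ℕ} {hd : 1 ≤ d + 1} {hL : Odd (ℓ + 1) ∧ 1 < ℓ + 1} {a₀ a₁ : ℝ} {m K : ℕ} {Mh k R : ℕ} {P' : Fin (d + 1) → ℕ}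

/-! ## §1  Generic letters: a bounded left multiplier; the bond identities `h·∇*_ν`, `∇*_ν = −S_ν⁻¹∇_ν`, `χ·S_ν⁻¹` -/

section Generic

variable {g : B6.Geometry} {X : Type} (blk : X → g.Site) {adm : (X → ℝ) → g.Site → ℝ → Prop}

/-- a left multiplier of size `≤ s` scales an admissible-input majorant (with nonnegative kernel) by `s`.
[cite: Balaban1984PropagatorsII, (2.92) p.239 (line 1: the coefficients `∂h_□`), bookkeeping] -/
theorem hasMajorantA_mulOp_left_le {T : Module.End ℝ (X → ℝ)} {f : X → ℝ} {K : g.Site → g.Site → ℝ} {s : ℝ}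
    (hfle : ∀ x, |f x| ≤ s) (hK : ∀ a b, 0 ≤ K a b) (hadm : ∀ (μ : X → ℝ) (y' : g.Site) (B : ℝ), adm μ y' B → 0 ≤ B)
    (hT : HasMajorantA blk adm T K) : HasMajorantA blk adm (mulOp f * T) (fun a b => s * K a b) := by
  intro y' μ B hμ x
  rw [Module.End.mul_apply, mulOp_apply, abs_mul]
  have h1 := hT y' μ B hμ x
  have h2 : 0 ≤ K (blk x) y' * B := mul_nonneg (hK _ _) (hadm μ y' B hμ)
  calc |f x| * |T μ x| ≤ s * (K (blk x) y' * B) := mul_le_mul (hfle x) h1 (abs_nonneg _) ((abs_nonneg _).trans (hfle x))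
    _ = s * K (blk x) y' * B := by ring

end Generic

section BondAlgebra

variable {P : Params}

/-- **`h·∇*_ν = ∇*_ν·(S_νh) + (∇_νh)·`** — the transpose of p38's `DV_mul_mulOp` (`∇_ν·h = (S_νh)·∇_ν + (∇_νh)·`).
[cite: Balaban1984PropagatorsI, (1.4) p.18, (1.89) p.33 (product rule for lattice differences)] -/
theorem mulOp_mul_DVa (ν : Fin P.d) (cf : ℝ) (h : PBond P 0 → ℝ) :
    mulOp h * DVa ν cf = DVa ν cf * mulOp (shB ν h) + mulOp (DV ν cf h) := by
  apply LinearMap.ext; intro f; funext b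
  simp only [Module.End.mul_apply, LinearMap.add_apply, Pi.add_apply, mulOp_apply, DVa_apply, shB_apply, DV_apply, shift_unshift]
  ring

/-- **`∇*_ν = −S_ν⁻¹·∇_ν`** on the fine bonds of the torus. [cite: Balaban1984PropagatorsI, (1.4) p.18, (1.89) p.33] -/
theorem DVa_eq_neg_shBi_mul_DV (ν : Fin P.d) (cf : ℝ) : DVa (P := P) ν cf = -(shBi ν * DV ν cf) := by
  apply LinearMap.ext; intro f; funext b
  simp only [Module.End.mul_apply, LinearMap.neg_apply, Pi.neg_apply, DVa_apply, shBi_apply, DV_apply, shift_unshift]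
  ring

/-- **`χ·S_ν⁻¹ = S_ν⁻¹·(S_νχ)·`**. [cite: Balaban1984PropagatorsI, (1.4) p.18, bookkeeping] -/
theorem mulOp_mul_shBi (ν : Fin P.d) (χ : PBond P 0 → ℝ) : mulOp χ * shBi ν = shBi ν * mulOp (shB ν χ) := by
  apply LinearMap.ext; intro f; funext b
  simp only [Module.End.mul_apply, mulOp_apply, shBi_apply, shB_apply, shift_unshift]

end BondAlgebra

/-! ## §2  The cube: depth of the coefficients `c_e` in the window, the window identities, the backward shift -/

section Cube

variable (hN : ∀ μ, N0 ℓ Mh k P' μ = (PV d ℓ m K hd hL).sitesPerDir 0) {D : TDomains d ℓ Mh k P' R} (hk : k ≤ m + K)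
  (hMh1 : 1 ≤ Mh) (hP4 : ∀ μ, 4 ≤ P' μ) {a : ℕ} (hMha : Mh = (ℓ + 1) ^ a) (c : ↥(cubes D.toDomains)) (ha : a₀ ≤ a₁)

include hMha in
/-- the chart translate of the coefficient `c_e` is supported on `2`-deep bonds of the member's window (it is a nearest-neighbour difference of `h^ch_□`,
whose margin is `4L^{j₀+1} ≥ 3`). [cite: Balaban1984PropagatorsII, p.238 (□ ⊂ □̃³), (2.92) p.239 (line 1), bookkeeping] -/
theorem cfC_deep2 (hM8 : 8 ≤ Mh) (hR2 : 2 * (ℓ + 1) ^ 2 ≤ R) (hpl : Placed ℓ k P' c.1) (w : BondIdx (domT hN D hk) → ℝ) (cf : ℝ)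
    (e : Fin (d + 1) × Bool) (b : PBond (PV d ℓ m K hd hL) 0)
    (hb : trV (vch Mh k (svec ℓ k c.1.1 c.1.2)) (cfC hN hk hMh1 hP4 hMha c ha hpl w cf e) b ≠ 0) :
    b.src ∈ DeepS (tC hN hk hMh1 hP4 c ha a (wC hN hk c w) cf) (x0 ℓ Mh k c.1) 2 := by
  unfold cfC at hb
  rw [trV_trV_neg] at hb
  have hh := hch_deep1 hN hk hMh1 hP4 hMha c ha hM8 hR2 w cf
  have hmar : 3 ≤ 4 * (ℓ + 1) ^ (j0 hMh1 hP4 c + 1) := by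
    have : 1 ≤ (ℓ + 1) ^ (j0 hMh1 hP4 c + 1) := Nat.one_le_pow _ _ (Nat.succ_pos ℓ)
    omega
  have hdp : ∀ b' : PBond (PV d ℓ m K hd hL) 0, hch hN hMh1 hP4 c b' ≠ 0 →
      b'.src ∈ DeepS (tC hN hk hMh1 hP4 c ha a (wC hN hk c w) cf) (x0 ℓ Mh k c.1) 3 :=
    fun b' hb' => deepS_mono hmar (hch_deep hN hMh1 hP4 hMha c ha hM8 hR2 hb')
  obtain ⟨y, ν⟩ := b
  by_cases hy : y ∈ DeepS (tC hN hk hMh1 hP4 c ha a (wC hN hk c w) cf) (x0 ℓ Mh k c.1) 0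
  · obtain ⟨μ, s⟩ := e
    cases s
    · simp only [Bool.false_eq_true, if_false] at hb
      rw [extend_smul_Dla_apply _ hh μ y ν hy] at hb
      by_cases h1 : hch hN hMh1 hP4 c ⟨y, ν⟩ ≠ 0
      · exact deepS_mono (by norm_num) (hdp _ h1)
      · have h2 : hch hN hMh1 hP4 c ⟨y.unshift μ, ν⟩ ≠ 0 := by
          intro h0; apply hb; rw [not_not.1 h1, h0]; ring
        have h3 := hdp _ h2
        have h4 := (shift_mem_deepS (t := tC hN hk hMh1 hP4 c ha a (wC hN hk c w) cf) (hfit hN hMh1 hP4 hMha c ha hpl) (r := 2) h3 μ).1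
        simpa [shift_unshift] using h4
    · simp only [if_true] at hb
      rw [extend_smul_Dl_apply _ hh μ y ν hy] at hb
      by_cases h1 : hch hN hMh1 hP4 c ⟨y, ν⟩ ≠ 0
      · exact deepS_mono (by norm_num) (hdp _ h1)
      · have h2 : hch hN hMh1 hP4 c ⟨y.shift μ, ν⟩ ≠ 0 := by
          intro h0; apply hb; rw [not_not.1 h1, h0]; ring
        have h3 := hdp _ h2
        have h4 := (unshift_mem_deepS (t := tC hN hk hMh1 hP4 c ha a (wC hN hk c w) cf) (hx0 hpl) (r := 2) h3 μ).1
        simpa [unshift_shift] using h4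
  · exact absurd (extend_apply_of_not_mem _ hy) hb

include hMha in
/-- the chart translate of `S_λc_e` is supported on `1`-deep bonds. [cite: Balaban1984PropagatorsII, p.238 (□ ⊂ □̃³), bookkeeping] -/
theorem shB_cfC_deep1 (hM8 : 8 ≤ Mh) (hR2 : 2 * (ℓ + 1) ^ 2 ≤ R) (hpl : Placed ℓ k P' c.1) (w : BondIdx (domT hN D hk) → ℝ) (cf : ℝ)
    (e : Fin (d + 1) × Bool) (lam : Fin (d + 1)) (b : PBond (PV d ℓ m K hd hL) 0)
    (hb : trV (vch Mh k (svec ℓ k c.1.1 c.1.2)) (shB lam (cfC hN hk hMh1 hP4 hMha c ha hpl w cf e)) b ≠ 0) :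
    b.src ∈ DeepS (tC hN hk hMh1 hP4 c ha a (wC hN hk c w) cf) (x0 ℓ Mh k c.1) 1 := by
  rw [trV_shB, shB_apply] at hb
  have h2 := cfC_deep2 hN hk hMh1 hP4 hMha c ha hM8 hR2 hpl w cf e _ hb
  have h3 := (unshift_mem_deepS (t := tC hN hk hMh1 hP4 c ha a (wC hN hk c w) cf) (hx0 hpl) (r := 1) h2 lam).1
  simpa [unshift_shift] using h3

include hMha in
/-- **`∇*_ν·(S_νh_□) = (c′/L^{j₀})•E_(ν,−)·(S_νh_□)`** — the transpose of p38's `mulOp_mul_EC_true` at the `1`-deep multiplier `S_νh_□`.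
[cite: Balaban1984PropagatorsII, (2.94) p.239 (rescaling), (2.141) p.247, dictionary (charts)] -/
theorem DVa_mul_mulOp_shB_hB (hM8 : 8 ≤ Mh) (hR2 : 2 * (ℓ + 1) ^ 2 ≤ R) (hpl : Placed ℓ k P' c.1)
    (w : BondIdx (domT hN D hk) → ℝ) {cf : ℝ} (hcf : cf ≠ 0) (ν : Fin (d + 1)) :
    DVa (P := PV d ℓ m K hd hL) ν cf * mulOp (shB (P := PV d ℓ m K hd hL) ν (hB hN D c)) =
      (cf / (((ℓ + 1 : ℕ) : ℝ)) ^ j0 hMh1 hP4 c) •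
        (EC hN hk hMh1 hP4 hMha c ha hpl w cf (ν, false) * mulOp (shB (P := PV d ℓ m K hd hL) ν (hB hN D c))) := by
  have h := mulOp_mul_EC_true hN hk hMh1 hP4 hMha c ha hpl w hcf ν (shB (P := PV d ℓ m K hd hL) ν (hB hN D c))
    (fun b hb => shB_hB_deep hN hk hMh1 hP4 hMha c ha hM8 hR2 hpl w cf ν b hb)
  have ht := congrArg tr h
  rw [tr_mul, tr_smul, tr_mul, tr_mulOp, tr_EC, tr_DV] at ht
  have hL0 : ((((ℓ + 1 : ℕ) : ℝ)) ^ j0 hMh1 hP4 c) ≠ 0 := by positivity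
  have ht' : EC hN hk hMh1 hP4 hMha c ha hpl w cf (ν, false) * mulOp (shB (P := PV d ℓ m K hd hL) ν (hB hN D c)) =
      ((((ℓ + 1 : ℕ) : ℝ)) ^ j0 hMh1 hP4 c / cf) •
        (DVa (P := PV d ℓ m K hd hL) ν cf * mulOp (shB (P := PV d ℓ m K hd hL) ν (hB hN D c))) := ht
  rw [ht', smul_smul, div_mul_div_comm, mul_comm cf, div_self (mul_ne_zero hL0 hcf), one_smul]

include hMha in
/-- **`c_e·E_(λ,−) = −S_λ⁻¹·(S_λc_e)·E_(λ,+)`** for the coefficient `c_e` of a cube (`∇*_λ = −S_λ⁻¹∇_λ` inside the window, where `c_e` and `S_λc_e` are deep):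
the backward letter is the forward letter behind a unit shift. [cite: Balaban1984PropagatorsII, (2.92) p.239 (line 1), (2.94) p.239; Balaban1984PropagatorsI, (1.4) p.18, (1.89) p.33] -/
theorem mulOp_cfC_mul_EC_false (hM8 : 8 ≤ Mh) (hR2 : 2 * (ℓ + 1) ^ 2 ≤ R) (hpl : Placed ℓ k P' c.1)
    (w : BondIdx (domT hN D hk) → ℝ) {cf : ℝ} (hcf : cf ≠ 0) (e : Fin (d + 1) × Bool) (lam : Fin (d + 1)) :
    mulOp (cfC hN hk hMh1 hP4 hMha c ha hpl w cf e) * EC hN hk hMh1 hP4 hMha c ha hpl w cf (lam, false) =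
      shBi (P := PV d ℓ m K hd hL) lam * (mulOp (-shB (P := PV d ℓ m K hd hL) lam (cfC hN hk hMh1 hP4 hMha c ha hpl w cf e)) *
        EC hN hk hMh1 hP4 hMha c ha hpl w cf (lam, true)) := by
  have hL0 : ((((ℓ + 1 : ℕ) : ℝ)) ^ j0 hMh1 hP4 c) ≠ 0 := by positivity
  have e1 := mulOp_mul_EC_false hN hk hMh1 hP4 hMha c ha hpl w hcf lam (cfC hN hk hMh1 hP4 hMha c ha hpl w cf e)
    (fun b hb => deepS_mono (by norm_num) (cfC_deep2 hN hk hMh1 hP4 hMha c ha hM8 hR2 hpl w cf e b hb))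
  have e2 := mulOp_mul_EC_true hN hk hMh1 hP4 hMha c ha hpl w hcf lam (-shB (P := PV d ℓ m K hd hL) lam (cfC hN hk hMh1 hP4 hMha c ha hpl w cf e))
    (fun b hb => shB_cfC_deep1 hN hk hMh1 hP4 hMha c ha hM8 hR2 hpl w cf e lam b (by
      intro h0; apply hb; rw [trV_apply] at h0 ⊢; rw [Pi.neg_apply, h0, neg_zero]))
  -- `c_e·∇*_λ = S_λ⁻¹·(−S_λc_e)·∇_λ` on the torus
  have e3 : mulOp (cfC hN hk hMh1 hP4 hMha c ha hpl w cf e) * DVa (P := PV d ℓ m K hd hL) lam cf =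
      shBi (P := PV d ℓ m K hd hL) lam * (mulOp (-shB (P := PV d ℓ m K hd hL) lam (cfC hN hk hMh1 hP4 hMha c ha hpl w cf e)) *
        DV (P := PV d ℓ m K hd hL) lam cf) := by
    apply LinearMap.ext; intro f; funext b
    simp only [Module.End.mul_apply, mulOp_apply, DVa_apply, shBi_apply, shB_apply, DV_apply, Pi.neg_apply, shift_unshift]
    ring
  -- `(−S_λc_e)·∇_λ = (c′/L^{j₀})•(−S_λc_e)·E_(λ,+)`
  have e4 : mulOp (-shB (P := PV d ℓ m K hd hL) lam (cfC hN hk hMh1 hP4 hMha c ha hpl w cf e)) * DV (P := PV d ℓ m K hd hL) lam cf =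
      (cf / (((ℓ + 1 : ℕ) : ℝ)) ^ j0 hMh1 hP4 c) •
        (mulOp (-shB (P := PV d ℓ m K hd hL) lam (cfC hN hk hMh1 hP4 hMha c ha hpl w cf e)) * EC hN hk hMh1 hP4 hMha c ha hpl w cf (lam, true)) := by
    rw [e2, smul_smul, div_mul_div_comm, mul_comm cf, div_self (mul_ne_zero hL0 hcf), one_smul]
  rw [e1, e3, e4, mul_smul_comm, smul_smul, div_mul_div_comm, mul_comm _ cf, div_self (mul_ne_zero hcf hL0), one_smul]

include hMh1 in
/-- **A UNIT BACKWARD SHIFT COSTS `e^{ρ}`**: if `T ≺_adm C·e^{−ρd_T(y,y′)}·Q(y′)` then `S_λ⁻¹·T ≺_adm (C·e^{ρ})·e^{−ρd_T(y,y′)}·Q(y′)` — the output bond moves by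
`e_λ`, its block by at most `1` in `d_T` (`distT_shift_le_one`, (2.54)). [cite: Balaban1984PropagatorsII, (2.46) p.231, (2.54) p.232, bookkeeping] -/
theorem hasMajorantA_shBi_mul (hP : ∀ μ, 1 ≤ P' μ) {adm : (PBond (PV d ℓ m K hd hL) 0 → ℝ) → (geomT D).Site → ℝ → Prop}
    {T : Module.End ℝ (PBond (PV d ℓ m K hd hL) 0 → ℝ)} {C ρ : ℝ} {Q : (geomT D).Site → ℝ} (hC : 0 ≤ C) (hρ : 0 ≤ ρ) (hQ : ∀ b, 0 ≤ Q b)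
    (hadm : ∀ (μ : PBond (PV d ℓ m K hd hL) 0 → ℝ) (y' : (geomT D).Site) (B : ℝ), adm μ y' B → 0 ≤ B)
    (hT : HasMajorantA (g := geomT D) (blkV1 hN D) adm T (fun y y' => C * Real.exp (-(ρ * (geomT D).dist y y')) * Q y')) (lam : Fin (d + 1)) :
    HasMajorantA (g := geomT D) (blkV1 hN D) adm (shBi (P := PV d ℓ m K hd hL) lam * T)
      (fun y y' => (C * Real.exp ρ) * Real.exp (-(ρ * (geomT D).dist y y')) * Q y') := by
  intro y' μ B hμ x
  rw [Module.End.mul_apply, shBi_apply]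
  have h := hT y' μ B hμ ⟨x.src.unshift lam, x.dir⟩
  have hB := hadm μ y' B hμ
  have hQy := hQ y'
  -- the two output blocks are adjacent
  have h1 := distT_shift_le_one hN D (x.src.unshift lam) lam
  rw [shift_unshift] at h1
  have htri := (connectedT (D := D) hMh1 hP).dist_triangle (u := blkOf D.toDomains (toBox hN x.src))
    (v := blkOf D.toDomains (toBox hN (x.src.unshift lam))) (w := y')
  rw [SimpleGraph.dist_comm] at h1
  have hd : ((bondT D).dist (blkOf D.toDomains (toBox hN x.src)) y' : ℝ) ≤
      1 + ((bondT D).dist (blkOf D.toDomains (toBox hN (x.src.unshift lam))) y' : ℝ) := by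
    have : (bondT D).dist (blkOf D.toDomains (toBox hN x.src)) y' ≤ 1 + (bondT D).dist (blkOf D.toDomains (toBox hN (x.src.unshift lam))) y' := by
      omega
    exact_mod_cast this
  have hexp : Real.exp (-(ρ * (geomT D).dist (blkV1 hN D ⟨x.src.unshift lam, x.dir⟩) y')) ≤
      Real.exp ρ * Real.exp (-(ρ * (geomT D).dist (blkV1 hN D x) y')) := by
    rw [← Real.exp_add]
    refine Real.exp_le_exp.mpr ?_
    show -(ρ * ((bondT D).dist (blkOf D.toDomains (toBox hN (x.src.unshift lam))) y' : ℝ)) ≤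
      ρ + -(ρ * ((bondT D).dist (blkOf D.toDomains (toBox hN x.src)) y' : ℝ))
    nlinarith [mul_le_mul_of_nonneg_left hd hρ]
  calc |T μ ⟨x.src.unshift lam, x.dir⟩|
      ≤ C * Real.exp (-(ρ * (geomT D).dist (blkV1 hN D ⟨x.src.unshift lam, x.dir⟩) y')) * Q y' * B := h
    _ ≤ C * (Real.exp ρ * Real.exp (-(ρ * (geomT D).dist (blkV1 hN D x) y'))) * Q y' * B := by gcongr
    _ = _ := by ring

end Cube

/-! ## §3  THE LETTERS `c_e·E_e·G_□·h_□·∇*_ν` ON THE CENSUS HÖLDER CLASS -/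

section Letter

/-- an exponential kernel with a smaller rate dominates. [cite: Balaban1984PropagatorsII, (2.138) p.247, bookkeeping] -/
private theorem exp_le_exp_of_rate {ρ ρ' t : ℝ} (h : ρ' ≤ ρ) (ht : 0 ≤ t) : Real.exp (-(ρ * t)) ≤ Real.exp (-(ρ' * t)) :=
  Real.exp_le_exp.mpr (neg_le_neg (mul_le_mul_of_nonneg_right h ht))

set_option maxHeartbeats 1000000 in
-- ONE assembly proof carrying two operator identities, two letters and the kernel bookkeeping for both signs of `e` (~5× the default budget)
/-- **THE LINE-1 LETTERS `c_e·E_e·(G_□·h_□·∇*_ν)` OF (2.92) × (2.141) ON THE CENSUS HÖLDER CLASS, PER CUBE AND PER `e = (λ, ±)`** (`L ≥ 5`): there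
are `ρ > 0` (on `d, L, a₀, a₁`) and, for every `0 < ε < 1`, `C_ε ≥ 0` such that on every admissible V1 torus (`M_h = Lᵃ ≥ 8`, `R ≥ 2L²`, `P′ ≥ 5`, cube
placed), for every `c′ ≠ 0`, weights `w`, direction `ν`, `e`:
`HasMajorantA (geomT D) (blkV1 hN D) (NormSupp blkV1 {y′} (‖·‖_ε + |·|)) (c_e·E_e·(G_□·(h_□·∇*_ν))) (C_ε/(L·M_h)·e^{−ρd_T(y,y′)}·(|c′|/L^{j(y′)}))` — print's
`O(M⁻¹)·(L^{j′}η)⁻¹`-sized first-order term of `K_{□,□}G_□h_□∇*_ν` with the Hölder norm of `J` entering through the member (1.112).  Route (seat n03-b's,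
cell bus 2026-08-25T22:12Z): `h_□∇*_ν = ∇*_ν(S_νh_□) + (∇_νh_□)` and `∇*_ν(S_νh_□) = (c′/L^{j₀})•E_(ν,−)(S_νh_□)` (§2), so the letter is
`(c′/L^{j₀})•c_e·(E_eG_□E_(ν,−))·(S_νh_□) + c_e·(E_eG_□)·(∇_νh_□)`; the first summand is p27's Hölder-class letter `hEGE_cube` (for `e = (λ,−)` behind a unit
shift, `mulOp_cfC_mul_EC_false` + `hasMajorantA_shBi_mul`) with the right cut-off `S_νh_□` (`hasMajorantA_mul_right_ind`, `normSupp_mulOp`, `lip_shB_hB`) and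
the left coefficient `|c_e| ≤ s(□)L^{j₀}C1F/(8S/5)` (`abs_cfC_chart_le`); the second is the sup leg `hEGin_cube` sandwiched between `c_e` and
`|∇_νh_□| ≤ |c′|C1F/(8S/5)` (`hasMajorant_sandwich_in_both`), read on the Hölder class (`hasMajorantA_normSupp_of_sup`); `1/S ≤ 1/(M_h·L^{j(y′)})` on the reach.
[cite: Balaban1984PropagatorsII, (2.92) p.239 (line 1), (2.94) p.239, (2.134) p.247, (2.138) p.247, (2.141) p.247; Balaban1984PropagatorsI, Prop. 1.2 (1.112) p.36] -/
theorem lineOneE_hB_DVa_normSupp (d ℓ : ℕ) (hd : 1 ≤ d + 1) (hL : Odd (ℓ + 1) ∧ 1 < ℓ + 1) {a₀ a₁ : ℝ} (ha₀ : 0 < a₀) (ha₁ : a₀ ≤ a₁) :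
    ∃ ρ : ℝ, 0 < ρ ∧ ∀ ε : ℝ, 0 < ε → ε < 1 → ∃ C : ℝ, 0 ≤ C ∧ ∀ (m K : ℕ) {Mh k R : ℕ} {P' : Fin (d + 1) → ℕ}
      (hN : ∀ μ, N0 ℓ Mh k P' μ = (PV d ℓ m K hd hL).sitesPerDir 0) (D : TDomains d ℓ Mh k P' R) (hk : k ≤ m + K)
      (hMh1 : 1 ≤ Mh) (hP4 : ∀ μ, 4 ≤ P' μ) {a : ℕ} (hMha : Mh = (ℓ + 1) ^ a) (hM8 : 8 ≤ Mh) (hR2 : 2 * (ℓ + 1) ^ 2 ≤ R) (hP5 : ∀ μ, 5 ≤ P' μ)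
      (_ : 4 ≤ ℓ) (c : ↥(cubes D.toDomains)) (hpl : Placed ℓ k P' c.1) (w : BondIdx (domT hN D hk) → ℝ) {cf : ℝ} (hcf : cf ≠ 0)
      (ν : Fin (d + 1)) (e : Fin (d + 1) × Bool),
      HasMajorantA (g := geomT D) (blkV1 hN D)
        (NormSupp (g := geomT D) (blkV1 hN D) (fun y' => ({y'} : Set (geomT D).Site)) (fun _ J => holderV1 hN D ε J + supNormV1 J))
        (mulOp (cfC hN hk hMh1 hP4 hMha c ha₁ hpl w cf e) * EC hN hk hMh1 hP4 hMha c ha₁ hpl w cf e *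
          (Gl hN hk hMh1 hP4 hMha c ha₁ hpl w cf * (mulOp (hB hN D c) * DVa (P := PV d ℓ m K hd hL) ν cf)))
        (fun y y' => C / (((ℓ : ℝ) + 1) * Mh) * Real.exp (-(ρ * (geomT D).dist y y')) * (|cf| / (geomT D).len y')) := by
  obtain ⟨ρA, hρA, HA⟩ := hEGE_cube d ℓ hd hL ha₀ ha₁
  obtain ⟨ρE, hρE, CE, hCE, hEGin⟩ := hEGin_cube d ℓ hd hL ha₀ ha₁
  have hC1 := C1F_nonneg d ℓ
  refine ⟨min ρA ρE, lt_min hρA hρE, fun ε hε0 hε1 => ?_⟩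
  obtain ⟨CA, hCA, hA⟩ := HA ε hε0 hε1
  set Λ : ℝ := ((d : ℝ) + 1) * C1F d ℓ with hΛ
  have hΛ0 : 0 ≤ Λ := by positivity
  set L2 : ℝ := (((ℓ + 1 : ℕ) : ℝ)) ^ 2 with hL2
  refine ⟨((ℓ : ℝ) + 1) * ((1 + Λ) * CA * C1F d ℓ * Real.exp ρA + L2 * CE * C1F d ℓ * C1F d ℓ), by positivity, ?_⟩
  intro m K Mh k R P' hN D hk hMh1 hP4 a hMha hM8 hR2 hP5 hℓ c hpl w cf hcf ν e
  have hMh : 2 ≤ Mh := le_trans (by norm_num) hM8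
  have hR : 2 * (ℓ + 1) ≤ R := le_trans (by nlinarith : 2 * (ℓ + 1) ≤ 2 * (ℓ + 1) ^ 2) hR2
  have hP : ∀ μ, 1 ≤ P' μ := one_le_of_four_le hP4
  have hdnn : ∀ y y' : (geomT D).Site, 0 ≤ (geomT D).dist y y' := fun _ _ => Nat.cast_nonneg _
  have hcfpos : 0 < |cf| := abs_pos.2 hcf
  set S := ST D hMh1 hP4 c with hS
  set SR : ℝ := (bigSide ℓ Mh c.1.1 : ℝ) with hSR
  have hSR0 : 0 < SR := by rw [hSR]; unfold bigSide; positivity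
  set tD : ℝ := |cf| * (C1F d ℓ / (8 / 5 * SR)) with htD
  have htD0 : 0 ≤ tD := by positivity
  set sA : ℝ := sc hMh1 hP4 c cf * (((ℓ + 1 : ℕ) : ℝ)) ^ j0 hMh1 hP4 c * (C1F d ℓ / (8 / 5 * SR)) with hsA
  have hsc0 := sc_nonneg hMh1 hP4 c cf
  have hscne := sc_ne_zero hMh1 hP4 c hcf
  have hsA0 : 0 ≤ sA := by positivity
  have hadm : ∀ (J : PBond (PV d ℓ m K hd hL) 0 → ℝ) (y' : (geomT D).Site) (B : ℝ),
      NormSupp (g := geomT D) (blkV1 hN D) (fun y' => ({y'} : Set (geomT D).Site)) (fun _ J => holderV1 hN D ε J + supNormV1 J) J y' B → 0 ≤ B :=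
    fun _ _ _ hμ => hμ.nonneg
  -- sizes and supports of the multipliers
  have hcfle : ∀ x, |cfC hN hk hMh1 hP4 hMha c ha₁ hpl w cf e x| ≤ sA := fun x => by
    unfold cfC; rw [trV_apply]
    exact abs_cfC_chart_le hN hk hMh1 hP4 hMha c ha₁ hM8 hR2 hP5 hpl w cf e _
  have hcfsupp : ∀ x, cfC hN hk hMh1 hP4 hMha c ha₁ hpl w cf e x ≠ 0 → blkV1 hN D x ∈ S :=
    fun x hx => cfC_supp hN hk hMh1 hP4 hMha c ha₁ hM8 hR2 hP5 hpl w cf e x hx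
  have hSν_supp := supp_shB_hB hN hMh1 hP4 c hM8 hR hP5 ν
  have hSν_le : ∀ b, |shB (P := PV d ℓ m K hd hL) ν (hB hN D c) b| ≤ 1 := fun b => by rw [shB_apply]; exact abs_hB_le_one hN D hMh1 hP c _
  have hDν_supp := supp_DV_hB hN hMh1 hP4 c hMh hM8 hR hP5 cf ν
  have hDν_le := abs_DV_hB_le hN c hMh hR hP5 cf ν
  have hsupN : ∀ (y' : (geomT D).Site) (J : PBond (PV d ℓ m K hd hL) 0 → ℝ) (x : PBond (PV d ℓ m K hd hL) 0),
      |J x| ≤ holderV1 hN D ε J + supNormV1 J :=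
    fun y' J x => (abs_le_supNormV1 J x).trans (le_add_of_nonneg_left (holderV1_nonneg hN D ε J))
  -- the reach: `M_h·L^{j(y′)} ≤ S ≤ 8S/5` for `y′ ∈ Q_□`
  have hreach : ∀ y' ∈ S, (Mh : ℝ) * (geomT D).len y' ≤ 8 / 5 * SR := by
    intro y' hy'
    have hjy := level_le_of_mem_QT hMh1 hP4 c hR ((mem_ST D hMh1 hP4 c y').1 hy')
    have hL1 : (1 : ℝ) ≤ (ℓ : ℝ) + 1 := by linarith [(Nat.cast_nonneg ℓ : (0 : ℝ) ≤ ℓ)]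
    rw [lenT_eq]
    have e1 : SR = (Mh : ℝ) * ((ℓ : ℝ) + 1) ^ (c.1.1 + 1) := by rw [hSR]; unfold bigSide; push_cast; ring
    have h1 : ((ℓ : ℝ) + 1) ^ y'.1.1 ≤ ((ℓ : ℝ) + 1) ^ (c.1.1 + 1) := pow_le_pow_right₀ hL1 hjy
    have hMh0 : (0 : ℝ) ≤ Mh := Nat.cast_nonneg _
    nlinarith [mul_le_mul_of_nonneg_left h1 hMh0, show (0:ℝ) ≤ (Mh : ℝ) * ((ℓ : ℝ) + 1) ^ (c.1.1 + 1) by positivity]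
  -- (B) the sup leg `c_e·(E_eG_□)·(∇_νh_□)`, read on the Hölder class
  have hB0 := hasMajorant_sandwich_in_both (g := geomT D) (blkV1 hN D) (S := S) (s := sA) (t := tD)
    (f := cfC hN hk hMh1 hP4 hMha c ha₁ hpl w cf e) (h := DV (P := PV d ℓ m K hd hL) ν cf (hB hN D c))
    (K := fun y y' => CE * pref cf y * Real.exp (-(ρE * (geomT D).dist y y')))
    (fun y y' => by have := pref_nonneg cf y; positivity) hsA0 htD0 hcfsupp hcfle hDν_supp hDν_le
    (hEGin m K hN D hk hMh1 hP4 hMha hMh hR2 hℓ c hpl w cf e)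
  have hB1 := hasMajorantA_normSupp_of_sup (g := geomT D) (blkV1 hN D) (N := fun _ J => holderV1 hN D ε J + supNormV1 J) hsupN hB0
  -- (A) the Hölder-class letter with its right cut-off `S_νh_□`, for the forward direction `lam`
  have hAcut : ∀ lam : Fin (d + 1), HasMajorantA (g := geomT D) (blkV1 hN D)
      (NormSupp (g := geomT D) (blkV1 hN D) (fun y' => ({y'} : Set (geomT D).Site)) (fun _ J => holderV1 hN D ε J + supNormV1 J))
      (EC hN hk hMh1 hP4 hMha c ha₁ hpl w cf (lam, true) * Gl hN hk hMh1 hP4 hMha c ha₁ hpl w cf * EC hN hk hMh1 hP4 hMha c ha₁ hpl w cf (ν, false) *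
        mulOp (shB (P := PV d ℓ m K hd hL) ν (hB hN D c)))
      (fun y y' => ind S y' * ((1 + Λ) * ((sc hMh1 hP4 c cf)⁻¹ * (CA * Real.exp (-(ρA * (geomT D).dist y y')))))) := by
    intro lam
    have hA0 := hA m K hN D hk hMh1 hP4 hMha hMh hR2 hℓ c hpl w cf lam ν
    exact hasMajorantA_mul_right_ind (g := geomT D) (blkV1 hN D) S (κ := 1 + Λ) (E := mulOp (shB (P := PV d ℓ m K hd hL) ν (hB hN D c))) hA0
      (fun J y' B hJ _ => normSupp_mulOp hε1.le hΛ0 hSν_le (fun x x' hq => lip_shB_hB hN hk hMh1 hP4 hMha c hM8 hR2 hP5 hpl ν hq) hJ)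
      (fun J y' B hJ hy => mulOp_eq_zero_of_region (g := geomT D) (blkV1 hN D) (R := fun y' => ({y'} : Set (geomT D).Site))
        (fun x hx => by
          by_contra hne
          exact hx (hJ.off x hne))
        (fun x hx y'' hmem => by
          rw [Set.mem_singleton_iff] at hmem
          rw [← hmem]
          exact hSν_supp x hx) hy)
  -- the generic operator identity
  have hop : mulOp (cfC hN hk hMh1 hP4 hMha c ha₁ hpl w cf e) * EC hN hk hMh1 hP4 hMha c ha₁ hpl w cf e *
      (Gl hN hk hMh1 hP4 hMha c ha₁ hpl w cf * (mulOp (hB hN D c) * DVa (P := PV d ℓ m K hd hL) ν cf)) =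
      (cf / (((ℓ + 1 : ℕ) : ℝ)) ^ j0 hMh1 hP4 c) •
        (mulOp (cfC hN hk hMh1 hP4 hMha c ha₁ hpl w cf e) *
          (EC hN hk hMh1 hP4 hMha c ha₁ hpl w cf e * Gl hN hk hMh1 hP4 hMha c ha₁ hpl w cf * EC hN hk hMh1 hP4 hMha c ha₁ hpl w cf (ν, false) *
            mulOp (shB (P := PV d ℓ m K hd hL) ν (hB hN D c)))) +
      mulOp (cfC hN hk hMh1 hP4 hMha c ha₁ hpl w cf e) * (EC hN hk hMh1 hP4 hMha c ha₁ hpl w cf e * Gl hN hk hMh1 hP4 hMha c ha₁ hpl w cf) *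
        mulOp (DV (P := PV d ℓ m K hd hL) ν cf (hB hN D c)) := by
    rw [mulOp_mul_DVa, DVa_mul_mulOp_shB_hB hN hk hMh1 hP4 hMha c ha₁ hM8 hR2 hpl w hcf ν]
    simp only [mul_add, mul_smul_comm, mul_assoc]
  -- the kernel facts on the reach
  have hker : ∀ y y' : (geomT D).Site, ∀ sh : ℝ, 1 ≤ sh → sh ≤ Real.exp ρA →
      |cf / (((ℓ + 1 : ℕ) : ℝ)) ^ j0 hMh1 hP4 c| *
          (sA * (1 + Λ) * (sc hMh1 hP4 c cf)⁻¹ * CA * sh * Real.exp (-(ρA * (geomT D).dist y y')) * ind S y') +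
        ind S y * ind S y' * (sA * tD * (CE * pref cf y * Real.exp (-(ρE * (geomT D).dist y y')))) ≤
      ((ℓ : ℝ) + 1) * ((1 + Λ) * CA * C1F d ℓ * Real.exp ρA + L2 * CE * C1F d ℓ * C1F d ℓ) / (((ℓ : ℝ) + 1) * Mh) *
        Real.exp (-(min ρA ρE * (geomT D).dist y y')) * (|cf| / (geomT D).len y') := by
    intro y y' sh hsh1 hshA
    have hd0 := hdnn y y'
    have hly' : 0 < (geomT D).len y' := lenT_pos D y'
    have hMh0 : (0 : ℝ) < Mh := by exact_mod_cast (lt_of_lt_of_le (by norm_num) hM8)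
    have hL1 : (0 : ℝ) < (ℓ : ℝ) + 1 := by positivity
    have hsh0 : 0 ≤ sh := zero_le_one.trans hsh1
    have hRHS0 : 0 ≤ ((ℓ : ℝ) + 1) * ((1 + Λ) * CA * C1F d ℓ * Real.exp ρA + L2 * CE * C1F d ℓ * C1F d ℓ) / (((ℓ : ℝ) + 1) * Mh) *
        Real.exp (-(min ρA ρE * (geomT D).dist y y')) * (|cf| / (geomT D).len y') := by positivity
    by_cases hy' : y' ∈ S
    swap
    · rw [ind_of_not_mem hy']; simp only [mul_zero, zero_mul, add_zero]; exact hRHS0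
    rw [ind_of_mem hy', mul_one]
    set dd := (geomT D).dist y y' with hdd
    have eA := exp_le_exp_of_rate (ρ := ρA) (ρ' := min ρA ρE) (min_le_left _ _) hd0
    have eE := exp_le_exp_of_rate (ρ := ρE) (ρ' := min ρA ρE) (min_le_right _ _) hd0
    set eρ := Real.exp (-(min ρA ρE * dd)) with heρ
    have heρ0 : 0 ≤ eρ := Real.exp_nonneg _
    have habs : |cf / (((ℓ + 1 : ℕ) : ℝ)) ^ j0 hMh1 hP4 c| = |cf| / (((ℓ + 1 : ℕ) : ℝ)) ^ j0 hMh1 hP4 c := by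
      rw [abs_div, abs_of_pos (by positivity : (0 : ℝ) < (((ℓ + 1 : ℕ) : ℝ)) ^ j0 hMh1 hP4 c)]
    have hLj0 : (0 : ℝ) < (((ℓ + 1 : ℕ) : ℝ)) ^ j0 hMh1 hP4 c := by positivity
    -- `1/(8S/5) ≤ 1/(M_h·L^{j(y′)})`
    have hS1 : C1F d ℓ / (8 / 5 * SR) ≤ C1F d ℓ / ((Mh : ℝ) * (geomT D).len y') :=
      div_le_div_of_nonneg_left hC1 (by positivity) (hreach y' hy')
    -- (A)
    have h1 : |cf / (((ℓ + 1 : ℕ) : ℝ)) ^ j0 hMh1 hP4 c| * (sA * (1 + Λ) * (sc hMh1 hP4 c cf)⁻¹ * CA * sh * Real.exp (-(ρA * dd))) ≤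
        ((ℓ : ℝ) + 1) * ((1 + Λ) * CA * C1F d ℓ * Real.exp ρA) / (((ℓ : ℝ) + 1) * Mh) * eρ * (|cf| / (geomT D).len y') := by
      rw [habs, hsA]
      calc |cf| / (((ℓ + 1 : ℕ) : ℝ)) ^ j0 hMh1 hP4 c *
            (sc hMh1 hP4 c cf * (((ℓ + 1 : ℕ) : ℝ)) ^ j0 hMh1 hP4 c * (C1F d ℓ / (8 / 5 * SR)) * (1 + Λ) * (sc hMh1 hP4 c cf)⁻¹ * CA * sh *
              Real.exp (-(ρA * dd)))
          = (sc hMh1 hP4 c cf * (sc hMh1 hP4 c cf)⁻¹) * ((((ℓ + 1 : ℕ) : ℝ)) ^ j0 hMh1 hP4 c / (((ℓ + 1 : ℕ) : ℝ)) ^ j0 hMh1 hP4 c) *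
              (|cf| * (C1F d ℓ / (8 / 5 * SR)) * ((1 + Λ) * CA * sh) * Real.exp (-(ρA * dd))) := by ring
        _ = |cf| * (C1F d ℓ / (8 / 5 * SR)) * ((1 + Λ) * CA * sh) * Real.exp (-(ρA * dd)) := by
            rw [mul_inv_cancel₀ hscne, div_self (ne_of_gt hLj0), one_mul, one_mul]
        _ ≤ |cf| * (C1F d ℓ / ((Mh : ℝ) * (geomT D).len y')) * ((1 + Λ) * CA * Real.exp ρA) * eρ := by gcongr
        _ = ((ℓ : ℝ) + 1) * ((1 + Λ) * CA * C1F d ℓ * Real.exp ρA) / (((ℓ : ℝ) + 1) * Mh) * eρ * (|cf| / (geomT D).len y') := by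
            field_simp
    -- (B)
    have h2 : ind S y * 1 * (sA * tD * (CE * pref cf y * Real.exp (-(ρE * dd)))) ≤
        ((ℓ : ℝ) + 1) * (L2 * CE * C1F d ℓ * C1F d ℓ) / (((ℓ : ℝ) + 1) * Mh) * eρ * (|cf| / (geomT D).len y') := by
      by_cases hy : y ∈ S
      swap
      · rw [ind_of_not_mem hy]; simp only [zero_mul]; positivity
      rw [ind_of_mem hy, one_mul, one_mul, hsA, htD]
      have hps := pref_scale_le hL hMh1 hP4 c hR2 hcf hy
      have hll := len_lip_le hMh1 hP4 c hR hy
      have hlen0 : 0 ≤ (geomT D).len y := by rw [geomT_len]; positivity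
      have esc : sc hMh1 hP4 c cf * (((ℓ + 1 : ℕ) : ℝ)) ^ j0 hMh1 hP4 c = |cf| * (|cf| / (((ℓ + 1 : ℕ) : ℝ)) ^ j0 hMh1 hP4 c) := by
        unfold sc
        rw [div_pow, ← sq_abs cf]
        field_simp
      calc sc hMh1 hP4 c cf * (((ℓ + 1 : ℕ) : ℝ)) ^ j0 hMh1 hP4 c * (C1F d ℓ / (8 / 5 * SR)) * (|cf| * (C1F d ℓ / (8 / 5 * SR))) *
            (CE * pref cf y * Real.exp (-(ρE * dd)))
          = |cf| * CE * ((|cf| / (((ℓ + 1 : ℕ) : ℝ)) ^ j0 hMh1 hP4 c * pref cf y)) * (|cf| * (C1F d ℓ / (8 / 5 * SR))) *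
              (C1F d ℓ / (8 / 5 * SR)) * Real.exp (-(ρE * dd)) := by rw [esc]; ring
        _ ≤ |cf| * CE * (L2 * ((geomT D).len y * |cf|⁻¹)) * (|cf| * (C1F d ℓ / (8 / 5 * SR))) *
              (C1F d ℓ / ((Mh : ℝ) * (geomT D).len y')) * eρ := by gcongr
        _ = L2 * CE * (|cf| * |cf|⁻¹) * |cf| * ((geomT D).len y * (C1F d ℓ / (8 / 5 * SR))) * (C1F d ℓ / ((Mh : ℝ) * (geomT D).len y')) * eρ := by
              ring
        _ ≤ L2 * CE * 1 * |cf| * C1F d ℓ * (C1F d ℓ / ((Mh : ℝ) * (geomT D).len y')) * eρ := by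
              rw [mul_inv_cancel₀ (ne_of_gt hcfpos)]; gcongr
        _ = ((ℓ : ℝ) + 1) * (L2 * CE * C1F d ℓ * C1F d ℓ) / (((ℓ : ℝ) + 1) * Mh) * eρ * (|cf| / (geomT D).len y') := by
              field_simp
    have hsum := add_le_add h1 h2
    refine hsum.trans (le_of_eq ?_)
    ring
  -- the two directions of `e`
  obtain ⟨lam, s⟩ := e
  cases s
  · -- `e = (λ, −)`: the Hölder-class letter behind a unit backward shift
    have hA1 := hAcut lam
    have hA2 := hasMajorantA_mulOp_left_le (g := geomT D) (blkV1 hN D)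
      (f := -shB (P := PV d ℓ m K hd hL) lam (cfC hN hk hMh1 hP4 hMha c ha₁ hpl w cf (lam, false))) (s := sA)
      (fun x => by rw [Pi.neg_apply, abs_neg, shB_apply]; exact hcfle _)
      (fun y y' => by have := ind_nonneg S y'; positivity) hadm hA1
    -- reshape the kernel to `C·e^{−ρ_A d}·Q(y′)` and shift
    have hA3 : HasMajorantA (g := geomT D) (blkV1 hN D)
        (NormSupp (g := geomT D) (blkV1 hN D) (fun y' => ({y'} : Set (geomT D).Site)) (fun _ J => holderV1 hN D ε J + supNormV1 J))
        (mulOp (-shB (P := PV d ℓ m K hd hL) lam (cfC hN hk hMh1 hP4 hMha c ha₁ hpl w cf (lam, false))) *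
          (EC hN hk hMh1 hP4 hMha c ha₁ hpl w cf (lam, true) * Gl hN hk hMh1 hP4 hMha c ha₁ hpl w cf *
            EC hN hk hMh1 hP4 hMha c ha₁ hpl w cf (ν, false) * mulOp (shB (P := PV d ℓ m K hd hL) ν (hB hN D c))))
        (fun y y' => (sA * (1 + Λ) * (sc hMh1 hP4 c cf)⁻¹ * CA) * Real.exp (-(ρA * (geomT D).dist y y')) * ind S y') :=
      hasMajorantA_mono (g := geomT D) (blkV1 hN D) hA2 hadm fun y y' => le_of_eq (by ring)
    have hA4 := hasMajorantA_shBi_mul hN (D := D) hMh1 hP (by positivity) hρA.le (fun b => ind_nonneg S b) hadm hA3 lam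
    have hA5 := hasMajorantA_smul (g := geomT D) (blkV1 hN D) hA4 (cf / (((ℓ + 1 : ℕ) : ℝ)) ^ j0 hMh1 hP4 c)
    -- the operator identity in the backward direction
    have hopF : mulOp (cfC hN hk hMh1 hP4 hMha c ha₁ hpl w cf (lam, false)) *
        (EC hN hk hMh1 hP4 hMha c ha₁ hpl w cf (lam, false) * Gl hN hk hMh1 hP4 hMha c ha₁ hpl w cf * EC hN hk hMh1 hP4 hMha c ha₁ hpl w cf (ν, false) *
          mulOp (shB (P := PV d ℓ m K hd hL) ν (hB hN D c))) =
        shBi (P := PV d ℓ m K hd hL) lam *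
          (mulOp (-shB (P := PV d ℓ m K hd hL) lam (cfC hN hk hMh1 hP4 hMha c ha₁ hpl w cf (lam, false))) *
            (EC hN hk hMh1 hP4 hMha c ha₁ hpl w cf (lam, true) * Gl hN hk hMh1 hP4 hMha c ha₁ hpl w cf *
              EC hN hk hMh1 hP4 hMha c ha₁ hpl w cf (ν, false) * mulOp (shB (P := PV d ℓ m K hd hL) ν (hB hN D c)))) := by
      have h3 := mulOp_cfC_mul_EC_false hN hk hMh1 hP4 hMha c ha₁ hM8 hR2 hpl w hcf (lam, false) lam
      calc mulOp (cfC hN hk hMh1 hP4 hMha c ha₁ hpl w cf (lam, false)) *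
            (EC hN hk hMh1 hP4 hMha c ha₁ hpl w cf (lam, false) * Gl hN hk hMh1 hP4 hMha c ha₁ hpl w cf *
              EC hN hk hMh1 hP4 hMha c ha₁ hpl w cf (ν, false) * mulOp (shB (P := PV d ℓ m K hd hL) ν (hB hN D c)))
          = (mulOp (cfC hN hk hMh1 hP4 hMha c ha₁ hpl w cf (lam, false)) * EC hN hk hMh1 hP4 hMha c ha₁ hpl w cf (lam, false)) *
              (Gl hN hk hMh1 hP4 hMha c ha₁ hpl w cf * EC hN hk hMh1 hP4 hMha c ha₁ hpl w cf (ν, false) *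
                mulOp (shB (P := PV d ℓ m K hd hL) ν (hB hN D c))) := by simp only [mul_assoc]
        _ = _ := by rw [h3]; simp only [mul_assoc]
    rw [hop, hopF]
    refine hasMajorantA_mono (g := geomT D) (blkV1 hN D) (hasMajorantA_add (g := geomT D) (blkV1 hN D) hA5 hB1) hadm fun y y' => ?_
    have hk := hker y y' (Real.exp ρA) (Real.one_le_exp hρA.le) le_rfl
    refine le_trans (le_of_eq ?_) hk
    ring
  · -- `e = (λ, +)`: p27's letter directly
    have hA1 := hAcut lam
    have hA2 := hasMajorantA_mulOp_left_le (g := geomT D) (blkV1 hN D) (f := cfC hN hk hMh1 hP4 hMha c ha₁ hpl w cf (lam, true)) (s := sA)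
      hcfle (fun y y' => by have := ind_nonneg S y'; positivity) hadm hA1
    have hA5 := hasMajorantA_smul (g := geomT D) (blkV1 hN D) hA2 (cf / (((ℓ + 1 : ℕ) : ℝ)) ^ j0 hMh1 hP4 c)
    rw [hop]
    refine hasMajorantA_mono (g := geomT D) (blkV1 hN D) (hasMajorantA_add (g := geomT D) (blkV1 hN D) hA5 hB1) hadm fun y y' => ?_
    have hk := hker y y' 1 le_rfl (Real.one_le_exp hρA.le)
    refine le_trans (le_of_eq ?_) hk
    ring

end Letter


end Literature.MathematicalPhysics.QuantumFieldTheory.Balaban1983to89.B6LineOneENormSuppKLevelV1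

end
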